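import Summits.QuantumFields.BalabanUV.Beta.D1BFx.PackedRoadK6cSkeletonNN
import Summits.QuantumFields.BalabanUV.Beta.D1BFx.RestKernelGhostWords
import Summits.QuantumFields.BalabanUV.Beta.D1BFx.GluonLegTails

/-!
# `BalabanUV.Beta.D1BFx.PackedRoadHptwScales` — road «BF-x» for binder row D1, slot (K): PART 10 «`hptw` AT EVERY ONE-SHOT SCALE» —
# **the POINTWISE DICTIONARY binder `hptw` of the road's END `RoadEndBFxDictPointwiseS.hdict_of_pointwise` ∕ `d1Rep_BFx_of_D1Tel_ptw_sbpS`,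
# with its six rest words written out, FROM the junctions (J1)(J2)(J3), the literal's structural sockets, its per-bond torus pins and its
# LIFTED table-level Ward identities [P1′]∕[P2′] — at every one-shot scale `n = Lc^m`, `m ≥ 1`.**

This is leaf-03 g24's «PART 8-NN» `PackedRoadK6cSkeletonNN.tshot_eq_hptw_form_of_junctions_NN` (= the owner's PART 8 `PackedRoadK6cSkeleton` p324577 with
the N side fully explicit by (D) PART II `PackedNSidePair`) RE-BASED on the scale `n` itself (`m + 1 ↦ n`, `m ↦ n − 1`, once, by `obtain ⟨M, rfl⟩`) with:
* the torus RESPONSES `rS rT`, the packed CO-FRAME data `T₀ Tₛ Tₜ Tₛₜ A₀ Aₛ Aₜ Aₛₜ` and the form ∕ constraint jets `kₛ kₜ kₛₜ qₛ qₜ qₛₜ` NO LONGER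
  DISPLAYED — they were pins of free matrices to closed terms and are instantiated by `rfl` (§1 `tshot_eq_hptw_form_at`);
* the sixteen-slot ghost rest bracket `R₁₆` written as `Σ_{i : GhIdx} ghostWordK (Ggh n a) (Pgt n a) 𝒱gh 𝒲gh i μ ν z` at the road's `colH G₀`-packed ghost
  jets (`RestKernelGhostWords.pRemK_sixteen_eq_sum_ghostWordK`, leaf-01; their junction J51);
* §2 `hptw_of_junctions`: the per-scale data as FAMILIES in the scale (`r n`, `S n`, `S₂ n`, `p n`, `K₁ n … x₂ n`, `RJ2 n`, `RJ3 n`), every hypothesis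
  in the END's `∀ n, 2 ≤ n → ∀ [NeZero n], …` currency, (J2)∕(J3) READ AT THE END's OWN LETTERS (`ωgl n`, `SbfBal n a (cE n) …`, `tableRed n (Wbf …)`;
  `ωgh n`, `x₀ n`, `cK n`, `cQ n`), (J1) per exponent `m` (`TshotOf Lc Jc m`), and `Spr (Ga n a)` DISCHARGED from [B5] Prop. 1.2 ∧ (1.126)–(1.127)
  BY NAME (`GluonLegTails.spr_Ga_of_prop12`) ⇒ THE CONCLUSION IS `hdict_of_pointwise`'s `hptw` with `Σ_u Rk u (Lc^m) μ ν z` spelled as the six words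
  (sandwich `legCross`, `blockTerms`, comb-FP, `RJ2`, `RJ3`, ghost `Σ ghostWordK`); PART 11 packs them into `Rk := Sum.elim` of the lanes' SLOT PACKs.

HONEST DEPENDENCY (cell records, verbatim): «continuum YM on T⁴ ⇐ BetaPertH ∧ nine spine estimates (0/9 proved); BetaPertH ⇐ (D1) ∧ (D4) ∧
CAP+tail; G-an2-4 gates asym, D1 and NE2/3/4.»  HONEST FRAMING (cell contract, verbatim): «discharging `BetaPertH` makes Bałaban's UV stability
UNCONDITIONAL — a real constructive-QFT result; it is NOT the continuum limit and NOT the Clay problem.»  THIS MODULE DISCHARGES NOTHING of (K),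
of D1 or of the wall: [folklore] composition BY NAME; (J1)(J2)(J3), the sockets and [P1′]∕[P2′] are HYPOTHESES.  No definition, no `def … : Prop`,
nothing cited, 0 sorry.  0 root-level binders of row D1 discharged; (K) NOT closed; NOT D1, NOT `BetaPertH`, NOT continuum, NOT Clay.

ABSOLUTE RULE (cell charter, verbatim): «No internally-minted statement may enter as a cited fact. Every hypothesis is either kernel-proved in this
package or a verbatim quotation of a PUBLISHED theorem with page reference. The manuscript(s) under audit are NOT citable for their own disputed
steps — they are the thing under adjudication; programme-internal (2001/route/tribunal) claims are never citable.»

CONTENT (all [folklore]): §1 **`tshot_eq_hptw_form_at`** (one scale `n`, pins discharged, ghost bracket as `Σ ghostWordK`); §2 **`hptw_of_junctions`** (all scales).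
Unit `b2b-balaban-beta-d1-p2` (road owner, gen 19), 2026-08-22.
-/

noncomputable section

namespace Summit.QuantumFields.BalabanUV.Beta.D1BFx.PackedRoadHptwScales

open Matrix Filter Topology
open scoped BigOperators Kronecker
open Literature.Probability.LatticeModels (TorusSite)
open Literature.MathematicalPhysics.QuantumFieldTheory.Balaban1983to89
open Literature.MathematicalPhysics.QuantumFieldTheory.Balaban1983to89.Beta
open Literature.MathematicalPhysics.QuantumFieldTheory.Balaban1983to89.Beta.Composition (kkt)
open B12Sec2to5 (l1 l1_nonneg)
open ExpKernelCalculus (MKer BiLoc comp hessKer shiftK tr Site)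
open OneStepKernelFamily (KInvStep colH vertexOfK TshotOf)
open Summit.QuantumFields.BalabanUV.Beta.AxialDressingRooted (coDressKBmAt coProjBmAtK)
open Summit.QuantumFields.BalabanUV.Beta.D1BFx.SortedKernels (fTL fBL)
open Summit.QuantumFields.BalabanUV.Beta.D1BFx.PackedNSideDictionary (SN)
open Summit.QuantumFields.BalabanUV.Beta.D1BFx.PackedNSidePair (W2NInf)
open AffineAveraging (box toSite unitVec)
open OneStepResolventKernel (Fib wsum LocStencil)
open SecondOrderResponse (vertex2OfK)
open Summit.QuantumFields.BalabanUV.Beta.TameKernelCalculus (Spr)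
open Summit.QuantumFields.BalabanUV.Beta.D1BFx.FibredPeriodisation (periodiseF)
open Summit.QuantumFields.BalabanUV.Beta.D1BFx.SortedPack (sortK)
open Summit.QuantumFields.BalabanUV.Beta.D1BFx.SortedReblocking (torusBlockEquiv)
open Summit.QuantumFields.BalabanUV.Beta.D1BFx.SortedEmbedding (e₁)
open Summit.QuantumFields.BalabanUV.Beta.D1BFx.PeriodicArrays (arr)
open Summit.QuantumFields.BalabanUV.Beta.D1BFx.TorusCombKKT (I J CombRows tauT Khat Qhat)
open Summit.QuantumFields.BalabanUV.Beta.D1BFx.TorusGaugeBasis (What0)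
open Summit.QuantumFields.BalabanUV.Beta.D1BFx.TorusGaugeBasisMatrix (Nhat)
open Summit.QuantumFields.BalabanUV.Beta.D1BFx.TorusCoframeJets (Djet Tjet₀ Tjet₁ Tjet₁₁ Ajet₀ Ajet₁ Ajet₁₁)
open Summit.QuantumFields.BalabanUV.Beta.D1BFx.RWeightedLegPack (NlegRoad)
open Summit.QuantumFields.BalabanUV.Beta.D1BFx.GaugeJetLocal (idK1)
open Summit.QuantumFields.BalabanUV.Beta.D1BFx.GhostStencil (ghCur)
open Summit.QuantumFields.BalabanUV.Beta.D1BFx.TorusGhostPairStencils (gh₂)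
open Summit.QuantumFields.BalabanUV.Beta.D1BFx.CombFPWordArrays (nFcol)
open Summit.QuantumFields.BalabanUV.Beta.D1BFx.WardJetsFromNoether (oslot)
open Summit.QuantumFields.BalabanUV.Beta.D1BFx.ColourLiftAdE3 (c₃)

open Summit.QuantumFields.BalabanUV.Beta.D1BFx.PackedKernelSplit (blk ffV ffW legCross blockTerms)
open Summit.QuantumFields.BalabanUV.Beta.D1BFx.ReducedKernelF (TOfLeg)
open Summit.QuantumFields.BalabanUV.Beta.D1BFx.CoarseGramInverse (multM)
open Summit.QuantumFields.BalabanUV.Beta.D1BFx.RWeightedLegPack (sandP)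
open Summit.QuantumFields.BalabanUV.Beta.D1BFx.GluonLeg (Ga)

open Summit.QuantumFields.BalabanUV.Beta.D1BFx.RProjector (Pgt)
open Summit.QuantumFields.BalabanUV.Beta.D1BFx.GhostLeg (Ggh)

open OneStepResolventKernel (JetData)
open Summit.QuantumFields.BalabanUV.Beta.D1BFx.ReducedKernel (TOfRed)
open Summit.QuantumFields.BalabanUV.Beta.D1BFx.GhostKernelComplete (PghQ)

open Summit.QuantumFields.BalabanUV.Beta.D1BFx.PackedRoadK6cSkeletonNN (tshot_eq_hptw_form_of_junctions_NN)
open Summit.QuantumFields.BalabanUV.Beta.D1BFx.RestKernelGhostWords (GhIdx ghostWordK pRemK_sixteen_eq_sum_ghostWordK)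
open Summit.QuantumFields.BalabanUV.Beta.D1BFx.GluonLegTails (spr_Ga_of_prop12)
open Summit.QuantumFields.BalabanUV.Beta.D1BFx.FrozenLegTails (nOf MOf hn1)
open VectorTailsLoc (fam kfam)
open Summit.QuantumFields.BalabanUV.Beta.D1BFx.FineStencilBFBalaban (SbfBal)
open Summit.QuantumFields.BalabanUV.Beta.D1BFx.SecondStencilBF (Wbf)
open Summit.QuantumFields.BalabanUV.Beta.D1BFx.DressedTadpoleTable (tableRed)
open Summit.QuantumFields.BalabanUV.Beta.D1BFx.ReducedKernel (TableR)

/-! ## §1 One scale `n`: PART 8-NN re-based on `n`, the torus pins discharged by `rfl`, the ghost bracket as `Σ ghostWordK` -/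

section OneScale

variable (n : ℕ) [NeZero n] {a : ℝ} {r : Fin 4 → ℕ}

/-- [folklore] **PART 8-NN AT THE SCALE `n` ITSELF, PINS DISCHARGED**: under the literal's structural sockets on `S`∕`S₂` (BLOCK covariance), the
per-bond torus pins `K₁ Q₁ x₁ K₂ Q₂ x₂`, the LIFTED [P1′]∕[P2′] (`C 2 = c₃`) on every torus of the sequence `p`, and the junctions (J1)(J2)(J3):
`TshotOf Lc Jc m₀ μ ν z = ωgl′·TOfRed n a SB TB μ ν z + ωgh′·PghQ n a x₀ cK cQ μ ν z + (legCross-word + blockTerms-word + comb-FP word + RJ2 + RJ3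
+ Σ_i ghostWordK (Ggh n a) (Pgt n a) 𝒱gh 𝒲gh i μ ν z)` — the N-side objects read `SN (n−1) a S`, `W2NInf (n−1) a r S₂`, `NlegRoad (n−1) a`
(their internal block size is `(n−1)+1 = n`). -/
theorem tshot_eq_hptw_form_at (ha : 0 < a) (hGa : Spr (GluonLeg.Ga n a)) (hr : r ∈ box (3 + 1) n)
    -- the literal's first-derivative stencil family and its STRUCTURAL SOCKETS
    (S : Fin 4 → (Fin 4 → ℤ) → MKer 4 (Fib 3)) {Cs δS : ℝ} (hS : LocStencil S Cs δS) (hCs : 0 ≤ Cs) (hδS : 0 < δS)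
    (hScovB : ∀ κ' u t, S κ' (u + ((n : ℕ) : ℤ) • t) = shiftK (-(((n : ℕ) : ℤ) • t)) (S κ' u))
    (hSmm : ∀ κ' u x y (c b : Fin 4), S κ' u x y (Sum.inr c) (Sum.inr b) = 0)
    (hSfm : ∀ κ' u x y (c b : Fin 4), S κ' u x y (Sum.inl c) (Sum.inr b) = S κ' u y x (Sum.inr b) (Sum.inl c))
    (hSff : ∀ κ' u x y (c b : Fin 4), S κ' u x y (Sum.inl c) (Sum.inl b) = -S κ' u y x (Sum.inl b) (Sum.inl c))
    -- the literal's second-derivative stencil family and its STRUCTURAL SOCKETS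
    (S₂ : Fin 4 → (Fin 4 → ℤ) → Fin 4 → (Fin 4 → ℤ) → MKer 4 (Fib 3)) {Ck δ₂ : ℝ}
    (hS₂ : ∀ κ u κ' u', BiLoc (S₂ κ u κ' u') u u (Ck * Real.exp (-δ₂ * l1 (u' - u))) δ₂) (hCk : 0 ≤ Ck) (hδ₂ : 0 < δ₂)
    (hS₂covB : ∀ κ' κ'' u u' t, S₂ κ' (u + ((n : ℕ) : ℤ) • t) κ'' (u' + ((n : ℕ) : ℤ) • t)
      = shiftK (-(((n : ℕ) : ℤ) • t)) (S₂ κ' u κ'' u'))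
    (hS₂mm : ∀ κ u κ' u' x y (c b : Fin 4), S₂ κ u κ' u' x y (Sum.inr c) (Sum.inr b) = 0)
    (hS₂fm : ∀ κ u κ' u' x y (c b : Fin 4), S₂ κ u κ' u' x y (Sum.inl c) (Sum.inr b) = -S₂ κ u κ' u' y x (Sum.inr b) (Sum.inl c))
    (hS₂ff : ∀ κ u κ' u' x y (c b : Fin 4), S₂ κ u κ' u' x y (Sum.inl c) (Sum.inl b) = S₂ κ u κ' u' y x (Sum.inl b) (Sum.inl c))
    (μ ν : Fin 4) (z : Fin 4 → ℤ)
    {p : ℕ → ℕ} [∀ k, NeZero (p k)] (hp : Tendsto p atTop atTop)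
    -- the literal's per-bond torus data PINNED to the periodised single-bond ∕ pair stencil arrays and THE CONVENTION's generator jets
    (K₁ : ∀ k, I 3 n (p k) ⊕ J 3 (p k) → Matrix (I 3 n (p k)) (I 3 n (p k)) ℝ)
    (Q₁ : ∀ k, I 3 n (p k) ⊕ J 3 (p k) → Matrix (J 3 (p k)) (I 3 n (p k)) ℝ)
    (x₁ : ∀ k, I 3 n (p k) ⊕ J 3 (p k) → Matrix (I 3 n (p k)) (CombRows (toSite r) n (p k)) ℝ)
    (K₂ : ∀ k, I 3 n (p k) ⊕ J 3 (p k) → I 3 n (p k) ⊕ J 3 (p k) → Matrix (I 3 n (p k)) (I 3 n (p k)) ℝ)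
    (Q₂ : ∀ k, I 3 n (p k) ⊕ J 3 (p k) → I 3 n (p k) ⊕ J 3 (p k) → Matrix (J 3 (p k)) (I 3 n (p k)) ℝ)
    (x₂ : ∀ k, I 3 n (p k) ⊕ J 3 (p k) → I 3 n (p k) ⊕ J 3 (p k) → Matrix (I 3 n (p k)) (CombRows (toSite r) n (p k)) ℝ)
    (hK₁ : ∀ k i, K₁ k (Sum.inl i) = Matrix.of (periodiseF (p k) (fTL (sortK n (arr (n * p k)
      (S i.2.2 (windowMap 4 (n * p k) (torusBlockEquiv n (p k) (i.1, i.2.1)))))))))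
    (hQ₁ : ∀ k i, Q₁ k (Sum.inl i) = Matrix.of (periodiseF (p k) (fBL (sortK n (arr (n * p k)
      (S i.2.2 (windowMap 4 (n * p k) (torusBlockEquiv n (p k) (i.1, i.2.1)))))))))
    (hx₁ : ∀ k i, x₁ k (Sum.inl i) = (Djet (n * p k) (e₁ n (p k) i)).submatrix (e₁ n (p k)) id * Nhat r n (p k))
    (hK₂ : ∀ k i j, K₂ k (Sum.inl i) (Sum.inl j) = Matrix.of (periodiseF (p k) (fTL (sortK n (fun x y c b => ∑' t : Fin 4 → ℤ,
      arr (n * p k) (S₂ i.2.2 (windowMap 4 (n * p k) (torusBlockEquiv n (p k) (i.1, i.2.1))) j.2.2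
        (imageShift (n * p k) (windowMap 4 (n * p k) (torusBlockEquiv n (p k) (j.1, j.2.1))) t)) x y c b)))))
    (hQ₂ : ∀ k i j, Q₂ k (Sum.inl i) (Sum.inl j) = Matrix.of (periodiseF (p k) (fBL (sortK n (fun x y c b => ∑' t : Fin 4 → ℤ,
      arr (n * p k) (S₂ i.2.2 (windowMap 4 (n * p k) (torusBlockEquiv n (p k) (i.1, i.2.1))) j.2.2
        (imageShift (n * p k) (windowMap 4 (n * p k) (torusBlockEquiv n (p k) (j.1, j.2.1))) t)) x y c b)))))
    (hx₂ : ∀ k i j, x₂ k (Sum.inl i) (Sum.inl j) = if i = j then x₁ k (Sum.inl i) else 0)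
    (hK₁0 : ∀ k j, K₁ k (Sum.inr j) = 0) (hQ₁0 : ∀ k j, Q₁ k (Sum.inr j) = 0) (hx₁0 : ∀ k j, x₁ k (Sum.inr j) = 0)
    (hK₂0 : ∀ k j q, K₂ k (Sum.inr j) q = 0) (hK₂0' : ∀ k q j, K₂ k q (Sum.inr j) = 0)
    (hQ₂0 : ∀ k j q, Q₂ k (Sum.inr j) q = 0) (hQ₂0' : ∀ k q j, Q₂ k q (Sum.inr j) = 0)
    (hx₂0 : ∀ k j q, x₂ k (Sum.inr j) q = 0) (hx₂0' : ∀ k q j, x₂ k q (Sum.inr j) = 0)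
    -- the literal's LIFTED table-level Ward identities [P1′]∕[P2′] in the `ad e₃` model (ρ-g16-1′), per torus
    (C : Fin 3 → Matrix (Fin 3) (Fin 3) ℝ) (hC : C 2 = c₃)
    (hP1 : ∀ k, ∀ q : Fin 3 × (I 3 n (p k) ⊕ J 3 (p k)),
      (C q.1 ⊗ₖ kkt (K₁ k q.2) (Q₁ k q.2))
          * ((1 : Matrix (Fin 3) (Fin 3) ℝ) ⊗ₖ Matrix.fromRows (What0 r n (p k)) (0 : Matrix (J 3 (p k)) (CombRows (toSite r) n (p k)) ℝ))
      + ((1 : Matrix (Fin 3) (Fin 3) ℝ) ⊗ₖ kkt (Khat (d := 3) n (p k)) (Qhat (d := 3) n (p k)))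
          * (C q.1 ⊗ₖ Matrix.fromRows (x₁ k q.2) (0 : Matrix (J 3 (p k)) (CombRows (toSite r) n (p k)) ℝ))
      + oslot (fun q' : Fin 3 × (I 3 n (p k) ⊕ J 3 (p k)) =>
            C q'.1 ⊗ₖ Matrix.fromRows (x₁ k q'.2) (0 : Matrix (J 3 (p k)) (CombRows (toSite r) n (p k)) ℝ))
          (fun i => ((1 : Matrix (Fin 3) (Fin 3) ℝ) ⊗ₖ kkt (Khat (d := 3) n (p k)) (Qhat (d := 3) n (p k))) i q) = 0)
    (hP2 : ∀ k, ∀ q q'' : Fin 3 × (I 3 n (p k) ⊕ J 3 (p k)),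
      ((C q.1 * C q''.1) ⊗ₖ kkt (K₂ k q.2 q''.2) (Q₂ k q.2 q''.2))
          * ((1 : Matrix (Fin 3) (Fin 3) ℝ) ⊗ₖ Matrix.fromRows (What0 r n (p k)) (0 : Matrix (J 3 (p k)) (CombRows (toSite r) n (p k)) ℝ))
      + (C q.1 ⊗ₖ kkt (K₁ k q.2) (Q₁ k q.2))
          * (C q''.1 ⊗ₖ Matrix.fromRows (x₁ k q''.2) (0 : Matrix (J 3 (p k)) (CombRows (toSite r) n (p k)) ℝ))
      + (C q''.1 ⊗ₖ kkt (K₁ k q''.2) (Q₁ k q''.2))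
          * (C q.1 ⊗ₖ Matrix.fromRows (x₁ k q.2) (0 : Matrix (J 3 (p k)) (CombRows (toSite r) n (p k)) ℝ))
      + ((1 : Matrix (Fin 3) (Fin 3) ℝ) ⊗ₖ kkt (Khat (d := 3) n (p k)) (Qhat (d := 3) n (p k)))
          * ((C q.1 * C q''.1) ⊗ₖ Matrix.fromRows (x₂ k q.2 q''.2) (0 : Matrix (J 3 (p k)) (CombRows (toSite r) n (p k)) ℝ))
      + oslot (fun q' : Fin 3 × (I 3 n (p k) ⊕ J 3 (p k)) =>
            C q'.1 ⊗ₖ Matrix.fromRows (x₁ k q'.2) (0 : Matrix (J 3 (p k)) (CombRows (toSite r) n (p k)) ℝ))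
          (fun i => (C q''.1 ⊗ₖ kkt (K₁ k q''.2) (Q₁ k q''.2)) i q)
      + oslot (fun q' : Fin 3 × (I 3 n (p k) ⊕ J 3 (p k)) =>
            (C q''.1 * C q'.1) ⊗ₖ Matrix.fromRows (x₂ k q''.2 q'.2) (0 : Matrix (J 3 (p k)) (CombRows (toSite r) n (p k)) ℝ))
          (fun i => ((1 : Matrix (Fin 3) (Fin 3) ℝ) ⊗ₖ kkt (Khat (d := 3) n (p k)) (Qhat (d := 3) n (p k))) i q)
      + oslot (fun p' : Fin 3 × (I 3 n (p k) ⊕ J 3 (p k)) =>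
            (C q.1 * C p'.1) ⊗ₖ Matrix.fromRows (x₂ k q.2 p'.2) (0 : Matrix (J 3 (p k)) (CombRows (toSite r) n (p k)) ℝ))
          (fun i => ((1 : Matrix (Fin 3) (Fin 3) ℝ) ⊗ₖ kkt (Khat (d := 3) n (p k)) (Qhat (d := 3) n (p k))) i q'') = 0)
    -- (J1) S-LIT: the literal's one-shot kernel at scale `m₀` IS the road's main M-side object (d1-p3's `JcOf`; displayed)
    {Lc : ℕ} [NeZero Lc] (Jc : ∀ m : ℕ, JetData 3 (Lc ^ m)) (m₀ : ℕ)
    (hJ1 : TshotOf Lc Jc m₀ μ ν z = hessKer (coDressKBmAt (toSite r) n (KInvStep (d := 3) n 0))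
          (vertexOfK (coDressKBmAt (toSite r) n (KInvStep (d := 3) n 0)) n S)
          (vertex2OfK (coDressKBmAt (toSite r) n (KInvStep (d := 3) n 0)) n S₂) μ ν z)
    -- (J2) the (A2-N) TABLE dictionary: the road's gluon main word IS the END's reduced gluon word up to a rest (an2's Q-DICT-N; displayed)
    (ωgl' : ℝ) (SB : ReducedKernel.StencilR) (TB : ReducedKernel.TableR) (RJ2 : ℝ)
    (hJ2 : ((2 : ℝ)⁻¹) ^ 2 * TOfLeg n (Ga n a) (fun κ u => blk (coProjBmAtK (toSite r) n (SN (n - 1) a S) κ u) true true)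
            (fun μ' y ν' y' => ((2 : ℝ)⁻¹)⁻¹ • ffW (W2NInf (n - 1) a r S₂) μ' y ν' y') μ ν z
      = ωgl' * TOfRed n a SB TB μ ν z + RJ2)
    -- (J3) the ghost main word vs the END's ghost ray (Q-GH-W′; displayed)
    (ωgh' x₀ cK cQ RJ3 : ℝ)
    (hJ3 : -(2 * hessKer (Ggh n a) (fun κ' v => (((n : ℕ) : ℝ) ^ 2) • (fun x y a b => ∑ κ : Fin 4, wsum (colH (coDressKBmAt (toSite r) n (KInvStep (d := 3) n 0)) n κ' v κ) (ghCur κ) x y a b))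
          (fun κ' v l v' => (((n : ℕ) : ℝ) ^ 2) • (fun x y a b => ∑ κ : Fin 4,
            wsum (colH (coDressKBmAt (toSite r) n (KInvStep (d := 3) n 0)) n κ' v κ) (fun u => fun x y a b => colH (coDressKBmAt (toSite r) n (KInvStep (d := 3) n 0)) n l v' κ u * gh₂ κ u x y a b) x y a b)) μ ν z) = ωgh' * PghQ n a x₀ cK cQ μ ν z + RJ3) :
    TshotOf Lc Jc m₀ μ ν z
      = ωgl' * TOfRed n a SB TB μ ν z + ωgh' * PghQ n a x₀ cK cQ μ ν z
        + (legCross ((2 : ℝ)⁻¹ • Ga n a)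
            ((-(2 : ℝ)⁻¹) • blk (sandP n (Ga n a) (multM n (2 * a / ((n : ℕ) : ℝ) ^ 8) 2)) true true)
            (ffV (vertexOfK (coDressKBmAt (toSite r) n (KInvStep (d := 3) n 0)) n (SN (n - 1) a S))) (ffW (W2NInf (n - 1) a r S₂)) μ ν z
          + blockTerms (NlegRoad (n - 1) a) (vertexOfK (coDressKBmAt (toSite r) n (KInvStep (d := 3) n 0)) n (SN (n - 1) a S)) (W2NInf (n - 1) a r S₂) μ ν z
          + 2 * hessKer idK1
          (fun κ' v => fun x y c b => ∑ κ : Fin 4, wsum (colH (coDressKBmAt (toSite r) n (KInvStep (d := 3) n 0)) n κ' v κ) (nFcol r n κ) x y c b)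
          (fun κ' v l v' => fun x y c b => ∑ κ : Fin 4, wsum (colH (coDressKBmAt (toSite r) n (KInvStep (d := 3) n 0)) n κ' v κ)
            (fun u => fun x y c b => colH (coDressKBmAt (toSite r) n (KInvStep (d := 3) n 0)) n l v' κ u * nFcol r n κ u x y c b) x y c b)
          μ ν z
          + RJ2 + RJ3
          + ∑ i : GhIdx, ghostWordK (Ggh n a) (Pgt n a)
              (fun κ' v => (((n : ℕ) : ℝ) ^ 2) • (fun x y a b => ∑ κ : Fin 4,
                wsum (colH (coDressKBmAt (toSite r) n (KInvStep (d := 3) n 0)) n κ' v κ) (ghCur κ) x y a b))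
              (fun κ' v l v' => (((n : ℕ) : ℝ) ^ 2) • (fun x y a b => ∑ κ : Fin 4,
                wsum (colH (coDressKBmAt (toSite r) n (KInvStep (d := 3) n 0)) n κ' v κ)
                  (fun u => fun x y a b => colH (coDressKBmAt (toSite r) n (KInvStep (d := 3) n 0)) n l v' κ u * gh₂ κ u x y a b) x y a b))
              i μ ν z) := by
  obtain ⟨M, rfl⟩ : ∃ M, n = M + 1 := ⟨n - 1, (Nat.succ_pred_eq_of_ne_zero (NeZero.ne n)).symm⟩
  rw [Nat.add_sub_cancel] at hJ2 ⊢
  -- the responses `rS rT`, the co-frame data `T• A•` and the form ∕ constraint jets `k• q•` of PART 8-NN are pins of free matrices to closed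
  -- terms: instantiated by unification with `rfl`
  rw [tshot_eq_hptw_form_of_junctions_NN M ha hGa hr S hS hCs hδS hScovB hSmm hSfm hSff S₂ hS₂ hCk hδ₂ hS₂covB hS₂mm hS₂fm hS₂ff μ ν z hp
    _ _ (fun _ _ => rfl) (fun _ _ => rfl) _ _ _ _ _ _ _ _ (fun _ => rfl) (fun _ => rfl) (fun _ => rfl) (fun _ => rfl) (fun _ => rfl) (fun _ => rfl)
    (fun _ => rfl) (fun _ => rfl) K₁ Q₁ x₁ K₂ Q₂ x₂ hK₁ hQ₁ hx₁ hK₂ hQ₂ hx₂ hK₁0 hQ₁0 hx₁0 hK₂0 hK₂0' hQ₂0 hQ₂0' hx₂0 hx₂0' C hC hP1 hP2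
    _ _ _ _ _ _ (fun _ => rfl) (fun _ => rfl) (fun _ => rfl) (fun _ => rfl) (fun _ => rfl) (fun _ => rfl) Jc m₀ hJ1 ωgl' SB TB RJ2 hJ2 ωgh' x₀ cK cQ
    RJ3 hJ3, ← pRemK_sixteen_eq_sum_ghostWordK]

end OneScale


/-! ## §2 All scales: the END's `hptw` with its six rest words written out -/

/-- [folklore] **PART 10 «`hptw` AT EVERY ONE-SHOT SCALE».**  For per-scale block roots `r n`, literal stencil families `S n`∕`S₂ n` with their
STRUCTURAL SOCKETS (BLOCK covariance), torus sequences `p n` with the literal's per-bond data `K₁ n … x₂ n` PINNED and its LIFTED [P1′]∕[P2′]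
(`C 2 = c₃`) on every torus, the junctions (J1) (per exponent `m`, d1-p3's `JcOf`), (J2)∕(J3) (per scale, AT THE END's LETTERS, with rest KERNELS
`RJ2 n`, `RJ3 n`; an2's Q-DICT-N ∕ Q-GH-W′), `0 < a` and the printed tables [B5] Prop. 1.2 ∧ (1.126)–(1.127) BY NAME (⇒ `Spr (Ga n a)`):
THE POINTWISE DICTIONARY `hptw` of `RoadEndBFxDictPointwiseS.hdict_of_pointwise` holds at every `m ≥ 1`, `z`, with the rest sum `Σ_u Rk u (Lc^m) μ ν z`
SPELLED as the six words (sandwich `legCross`, `blockTerms`, comb-FP, `RJ2`, `RJ3`, ghost `Σ_i ghostWordK`).  HONEST: composition BY NAME; every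
junction ∕ socket ∕ Ward identity is a HYPOTHESIS; nothing of (K) is discharged. -/
theorem hptw_of_junctions {Lc : ℕ} [NeZero Lc] (hL : 2 ≤ Lc) {a : ℝ} (ha : 0 < a)
    (h12 : B5.Prop12Printed (fam nOf hn1 MOf a ha)) (h126 : B5.Kernel126_127Printed (kfam nOf MOf))
    -- the block roots, per scale
    (r : ℕ → Fin 4 → ℕ) (hr : ∀ n : ℕ, 2 ≤ n → ∀ [NeZero n], r n ∈ box (3 + 1) n)
    -- the literal's first-derivative stencil families, per scale, and their STRUCTURAL SOCKETS
    (S : ℕ → Fin 4 → (Fin 4 → ℤ) → MKer 4 (Fib 3)) {Cs δS : ℕ → ℝ} (hS : ∀ n : ℕ, 2 ≤ n → LocStencil (S n) (Cs n) (δS n))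
    (hCs : ∀ n, 0 ≤ Cs n) (hδS : ∀ n, 0 < δS n)
    (hScovB : ∀ n : ℕ, 2 ≤ n → ∀ κ' u t, S n κ' (u + ((n : ℕ) : ℤ) • t) = shiftK (-(((n : ℕ) : ℤ) • t)) (S n κ' u))
    (hSmm : ∀ n : ℕ, 2 ≤ n → ∀ κ' u x y (c b : Fin 4), S n κ' u x y (Sum.inr c) (Sum.inr b) = 0)
    (hSfm : ∀ n : ℕ, 2 ≤ n → ∀ κ' u x y (c b : Fin 4), S n κ' u x y (Sum.inl c) (Sum.inr b) = S n κ' u y x (Sum.inr b) (Sum.inl c))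
    (hSff : ∀ n : ℕ, 2 ≤ n → ∀ κ' u x y (c b : Fin 4), S n κ' u x y (Sum.inl c) (Sum.inl b) = -S n κ' u y x (Sum.inl b) (Sum.inl c))
    -- the literal's second-derivative stencil families, per scale, and their STRUCTURAL SOCKETS
    (S₂ : ℕ → Fin 4 → (Fin 4 → ℤ) → Fin 4 → (Fin 4 → ℤ) → MKer 4 (Fib 3)) {Ck δ₂ : ℕ → ℝ}
    (hS₂ : ∀ n : ℕ, 2 ≤ n → ∀ κ u κ' u', BiLoc (S₂ n κ u κ' u') u u (Ck n * Real.exp (-δ₂ n * l1 (u' - u))) (δ₂ n))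
    (hCk : ∀ n, 0 ≤ Ck n) (hδ₂ : ∀ n, 0 < δ₂ n)
    (hS₂covB : ∀ n : ℕ, 2 ≤ n → ∀ κ' κ'' u u' t, S₂ n κ' (u + ((n : ℕ) : ℤ) • t) κ'' (u' + ((n : ℕ) : ℤ) • t)
      = shiftK (-(((n : ℕ) : ℤ) • t)) (S₂ n κ' u κ'' u'))
    (hS₂mm : ∀ n : ℕ, 2 ≤ n → ∀ κ u κ' u' x y (c b : Fin 4), S₂ n κ u κ' u' x y (Sum.inr c) (Sum.inr b) = 0)
    (hS₂fm : ∀ n : ℕ, 2 ≤ n → ∀ κ u κ' u' x y (c b : Fin 4),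
      S₂ n κ u κ' u' x y (Sum.inl c) (Sum.inr b) = -S₂ n κ u κ' u' y x (Sum.inr b) (Sum.inl c))
    (hS₂ff : ∀ n : ℕ, 2 ≤ n → ∀ κ u κ' u' x y (c b : Fin 4),
      S₂ n κ u κ' u' x y (Sum.inl c) (Sum.inl b) = S₂ n κ u κ' u' y x (Sum.inl b) (Sum.inl c))
    -- the channel
    (μ ν : Fin 4)
    -- the torus sequences, per scale
    (p : ℕ → ℕ → ℕ) [∀ n k, NeZero (p n k)] (hp : ∀ n, Tendsto (p n) atTop atTop)
    -- the literal's per-bond torus data, per scale, PINNED to the periodised single-bond ∕ pair stencil arrays and THE CONVENTION's generator jets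
    (K₁ : ∀ (n : ℕ) [NeZero n] (k : ℕ), I 3 n (p n k) ⊕ J 3 (p n k) → Matrix (I 3 n (p n k)) (I 3 n (p n k)) ℝ)
    (Q₁ : ∀ (n : ℕ) [NeZero n] (k : ℕ), I 3 n (p n k) ⊕ J 3 (p n k) → Matrix (J 3 (p n k)) (I 3 n (p n k)) ℝ)
    (x₁ : ∀ (n : ℕ) [NeZero n] (k : ℕ), I 3 n (p n k) ⊕ J 3 (p n k) → Matrix (I 3 n (p n k)) (CombRows (toSite (r n)) n (p n k)) ℝ)
    (K₂ : ∀ (n : ℕ) [NeZero n] (k : ℕ), I 3 n (p n k) ⊕ J 3 (p n k) → I 3 n (p n k) ⊕ J 3 (p n k) → Matrix (I 3 n (p n k)) (I 3 n (p n k)) ℝ)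
    (Q₂ : ∀ (n : ℕ) [NeZero n] (k : ℕ), I 3 n (p n k) ⊕ J 3 (p n k) → I 3 n (p n k) ⊕ J 3 (p n k) → Matrix (J 3 (p n k)) (I 3 n (p n k)) ℝ)
    (x₂ : ∀ (n : ℕ) [NeZero n] (k : ℕ), I 3 n (p n k) ⊕ J 3 (p n k) → I 3 n (p n k) ⊕ J 3 (p n k) →
      Matrix (I 3 n (p n k)) (CombRows (toSite (r n)) n (p n k)) ℝ)
    (hK₁ : ∀ n : ℕ, 2 ≤ n → ∀ [NeZero n], ∀ k i, K₁ n k (Sum.inl i) = Matrix.of (periodiseF (p n k) (fTL (sortK n (arr (n * p n k)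
      (S n i.2.2 (windowMap 4 (n * p n k) (torusBlockEquiv n (p n k) (i.1, i.2.1)))))))))
    (hQ₁ : ∀ n : ℕ, 2 ≤ n → ∀ [NeZero n], ∀ k i, Q₁ n k (Sum.inl i) = Matrix.of (periodiseF (p n k) (fBL (sortK n (arr (n * p n k)
      (S n i.2.2 (windowMap 4 (n * p n k) (torusBlockEquiv n (p n k) (i.1, i.2.1)))))))))
    (hx₁ : ∀ n : ℕ, 2 ≤ n → ∀ [NeZero n], ∀ k i, x₁ n k (Sum.inl i) = (Djet (n * p n k) (e₁ n (p n k) i)).submatrix (e₁ n (p n k)) id * Nhat (r n) n (p n k))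
    (hK₂ : ∀ n : ℕ, 2 ≤ n → ∀ [NeZero n], ∀ k i j, K₂ n k (Sum.inl i) (Sum.inl j) = Matrix.of (periodiseF (p n k) (fTL (sortK n (fun x y c b => ∑' t : Fin 4 → ℤ,
      arr (n * p n k) (S₂ n i.2.2 (windowMap 4 (n * p n k) (torusBlockEquiv n (p n k) (i.1, i.2.1))) j.2.2
        (imageShift (n * p n k) (windowMap 4 (n * p n k) (torusBlockEquiv n (p n k) (j.1, j.2.1))) t)) x y c b)))))
    (hQ₂ : ∀ n : ℕ, 2 ≤ n → ∀ [NeZero n], ∀ k i j, Q₂ n k (Sum.inl i) (Sum.inl j) = Matrix.of (periodiseF (p n k) (fBL (sortK n (fun x y c b => ∑' t : Fin 4 → ℤ,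
      arr (n * p n k) (S₂ n i.2.2 (windowMap 4 (n * p n k) (torusBlockEquiv n (p n k) (i.1, i.2.1))) j.2.2
        (imageShift (n * p n k) (windowMap 4 (n * p n k) (torusBlockEquiv n (p n k) (j.1, j.2.1))) t)) x y c b)))))
    (hx₂ : ∀ n : ℕ, 2 ≤ n → ∀ [NeZero n], ∀ k i j, x₂ n k (Sum.inl i) (Sum.inl j) = if i = j then x₁ n k (Sum.inl i) else 0)
    (hK₁0 : ∀ n : ℕ, 2 ≤ n → ∀ [NeZero n], ∀ k j, K₁ n k (Sum.inr j) = 0) (hQ₁0 : ∀ n : ℕ, 2 ≤ n → ∀ [NeZero n], ∀ k j, Q₁ n k (Sum.inr j) = 0)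
    (hx₁0 : ∀ n : ℕ, 2 ≤ n → ∀ [NeZero n], ∀ k j, x₁ n k (Sum.inr j) = 0)
    (hK₂0 : ∀ n : ℕ, 2 ≤ n → ∀ [NeZero n], ∀ k j q, K₂ n k (Sum.inr j) q = 0) (hK₂0' : ∀ n : ℕ, 2 ≤ n → ∀ [NeZero n], ∀ k q j, K₂ n k q (Sum.inr j) = 0)
    (hQ₂0 : ∀ n : ℕ, 2 ≤ n → ∀ [NeZero n], ∀ k j q, Q₂ n k (Sum.inr j) q = 0) (hQ₂0' : ∀ n : ℕ, 2 ≤ n → ∀ [NeZero n], ∀ k q j, Q₂ n k q (Sum.inr j) = 0)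
    (hx₂0 : ∀ n : ℕ, 2 ≤ n → ∀ [NeZero n], ∀ k j q, x₂ n k (Sum.inr j) q = 0) (hx₂0' : ∀ n : ℕ, 2 ≤ n → ∀ [NeZero n], ∀ k q j, x₂ n k q (Sum.inr j) = 0)
    -- the literal's LIFTED table-level Ward identities [P1′]∕[P2′] in the `ad e₃` model (ρ-g16-1′), per torus
    (C : Fin 3 → Matrix (Fin 3) (Fin 3) ℝ) (hC : C 2 = c₃)
    (hP1 : ∀ n : ℕ, 2 ≤ n → ∀ [NeZero n], ∀ k, ∀ q : Fin 3 × (I 3 n (p n k) ⊕ J 3 (p n k)),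
      (C q.1 ⊗ₖ kkt (K₁ n k q.2) (Q₁ n k q.2))
          * ((1 : Matrix (Fin 3) (Fin 3) ℝ) ⊗ₖ Matrix.fromRows (What0 (r n) n (p n k)) (0 : Matrix (J 3 (p n k)) (CombRows (toSite (r n)) n (p n k)) ℝ))
      + ((1 : Matrix (Fin 3) (Fin 3) ℝ) ⊗ₖ kkt (Khat (d := 3) n (p n k)) (Qhat (d := 3) n (p n k)))
          * (C q.1 ⊗ₖ Matrix.fromRows (x₁ n k q.2) (0 : Matrix (J 3 (p n k)) (CombRows (toSite (r n)) n (p n k)) ℝ))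
      + oslot (fun q' : Fin 3 × (I 3 n (p n k) ⊕ J 3 (p n k)) =>
            C q'.1 ⊗ₖ Matrix.fromRows (x₁ n k q'.2) (0 : Matrix (J 3 (p n k)) (CombRows (toSite (r n)) n (p n k)) ℝ))
          (fun i => ((1 : Matrix (Fin 3) (Fin 3) ℝ) ⊗ₖ kkt (Khat (d := 3) n (p n k)) (Qhat (d := 3) n (p n k))) i q) = 0)
    (hP2 : ∀ n : ℕ, 2 ≤ n → ∀ [NeZero n], ∀ k, ∀ q q'' : Fin 3 × (I 3 n (p n k) ⊕ J 3 (p n k)),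
      ((C q.1 * C q''.1) ⊗ₖ kkt (K₂ n k q.2 q''.2) (Q₂ n k q.2 q''.2))
          * ((1 : Matrix (Fin 3) (Fin 3) ℝ) ⊗ₖ Matrix.fromRows (What0 (r n) n (p n k)) (0 : Matrix (J 3 (p n k)) (CombRows (toSite (r n)) n (p n k)) ℝ))
      + (C q.1 ⊗ₖ kkt (K₁ n k q.2) (Q₁ n k q.2))
          * (C q''.1 ⊗ₖ Matrix.fromRows (x₁ n k q''.2) (0 : Matrix (J 3 (p n k)) (CombRows (toSite (r n)) n (p n k)) ℝ))
      + (C q''.1 ⊗ₖ kkt (K₁ n k q''.2) (Q₁ n k q''.2))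
          * (C q.1 ⊗ₖ Matrix.fromRows (x₁ n k q.2) (0 : Matrix (J 3 (p n k)) (CombRows (toSite (r n)) n (p n k)) ℝ))
      + ((1 : Matrix (Fin 3) (Fin 3) ℝ) ⊗ₖ kkt (Khat (d := 3) n (p n k)) (Qhat (d := 3) n (p n k)))
          * ((C q.1 * C q''.1) ⊗ₖ Matrix.fromRows (x₂ n k q.2 q''.2) (0 : Matrix (J 3 (p n k)) (CombRows (toSite (r n)) n (p n k)) ℝ))
      + oslot (fun q' : Fin 3 × (I 3 n (p n k) ⊕ J 3 (p n k)) =>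
            C q'.1 ⊗ₖ Matrix.fromRows (x₁ n k q'.2) (0 : Matrix (J 3 (p n k)) (CombRows (toSite (r n)) n (p n k)) ℝ))
          (fun i => (C q''.1 ⊗ₖ kkt (K₁ n k q''.2) (Q₁ n k q''.2)) i q)
      + oslot (fun q' : Fin 3 × (I 3 n (p n k) ⊕ J 3 (p n k)) =>
            (C q''.1 * C q'.1) ⊗ₖ Matrix.fromRows (x₂ n k q''.2 q'.2) (0 : Matrix (J 3 (p n k)) (CombRows (toSite (r n)) n (p n k)) ℝ))
          (fun i => ((1 : Matrix (Fin 3) (Fin 3) ℝ) ⊗ₖ kkt (Khat (d := 3) n (p n k)) (Qhat (d := 3) n (p n k))) i q)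
      + oslot (fun p' : Fin 3 × (I 3 n (p n k) ⊕ J 3 (p n k)) =>
            (C q.1 * C p'.1) ⊗ₖ Matrix.fromRows (x₂ n k q.2 p'.2) (0 : Matrix (J 3 (p n k)) (CombRows (toSite (r n)) n (p n k)) ℝ))
          (fun i => ((1 : Matrix (Fin 3) (Fin 3) ℝ) ⊗ₖ kkt (Khat (d := 3) n (p n k)) (Qhat (d := 3) n (p n k))) i q'') = 0)
    -- (J1) S-LIT, per exponent: the spine's one-shot kernel at scale `Lc^m` IS the road's main M-side object (d1-p3's `JcOf`; displayed)
    (Jc : ∀ m : ℕ, JetData 3 (Lc ^ m))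
    (hJ1 : ∀ m : ℕ, 1 ≤ m → ∀ z : Site 4, TshotOf Lc Jc m μ ν z
      = hessKer (coDressKBmAt (toSite (r (Lc ^ m))) (Lc ^ m) (KInvStep (d := 3) (Lc ^ m) 0))
          (vertexOfK (coDressKBmAt (toSite (r (Lc ^ m))) (Lc ^ m) (KInvStep (d := 3) (Lc ^ m) 0)) (Lc ^ m) (S (Lc ^ m)))
          (vertex2OfK (coDressKBmAt (toSite (r (Lc ^ m))) (Lc ^ m) (KInvStep (d := 3) (Lc ^ m) 0)) (Lc ^ m) (S₂ (Lc ^ m))) μ ν z)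
    -- (J2) the (A2-N) TABLE dictionary AT THE END's LETTERS, per scale, with a rest KERNEL `RJ2 n` (an2's Q-DICT-N; displayed)
    {cE cVH cΛ cR cK cQ cE₂ cJ4 cΛ₂ cR₂ cQ₂ x₀ ωgl ωgh : ℕ → ℝ} {WE WJ WΛ WR WQ : ℕ → TableR}
    (RJ2 RJ3 : ℕ → Fin 4 → Fin 4 → Site 4 → ℝ)
    (hJ2 : ∀ n : ℕ, 2 ≤ n → ∀ [NeZero n], ∀ z : Site 4,
      ((2 : ℝ)⁻¹) ^ 2 * TOfLeg n (Ga n a) (fun κ u => blk (coProjBmAtK (toSite (r n)) n (SN (n - 1) a (S n)) κ u) true true)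
            (fun μ' y ν' y' => ((2 : ℝ)⁻¹)⁻¹ • ffW (W2NInf (n - 1) a (r n) (S₂ n)) μ' y ν' y') μ ν z
      = ωgl n * TOfRed n a (SbfBal n a (cE n) (cVH n) (cΛ n) (cR n) (cK n) (cQ n))
          (tableRed n (Wbf (cE₂ n) (cJ4 n) (cΛ₂ n) (cR₂ n) (cQ₂ n) (WE n) (WJ n) (WΛ n) (WR n) (WQ n))) μ ν z + RJ2 n μ ν z)
    -- (J3) the ghost main word vs the END's ghost ray AT THE END's LETTERS, per scale, with a rest KERNEL `RJ3 n` (Q-GH-W′; displayed)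
    (hJ3 : ∀ n : ℕ, 2 ≤ n → ∀ [NeZero n], ∀ z : Site 4,
      -(2 * hessKer (Ggh n a)
          (fun κ' v => (((n : ℕ) : ℝ) ^ 2) • (fun x y a b => ∑ κ : Fin 4,
            wsum (colH (coDressKBmAt (toSite (r n)) n (KInvStep (d := 3) n 0)) n κ' v κ) (ghCur κ) x y a b))
          (fun κ' v l v' => (((n : ℕ) : ℝ) ^ 2) • (fun x y a b => ∑ κ : Fin 4,
            wsum (colH (coDressKBmAt (toSite (r n)) n (KInvStep (d := 3) n 0)) n κ' v κ)
              (fun u => fun x y a b => colH (coDressKBmAt (toSite (r n)) n (KInvStep (d := 3) n 0)) n l v' κ u * gh₂ κ u x y a b) x y a b)) μ ν z)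
      = ωgh n * PghQ n a (x₀ n) (cK n) (cQ n) μ ν z + RJ3 n μ ν z) :
    ∀ m : ℕ, 1 ≤ m → ∀ z : Site 4, TshotOf Lc Jc m μ ν z
      = ωgl (Lc ^ m) * TOfRed (Lc ^ m) a
          (SbfBal (Lc ^ m) a (cE (Lc ^ m)) (cVH (Lc ^ m)) (cΛ (Lc ^ m)) (cR (Lc ^ m)) (cK (Lc ^ m)) (cQ (Lc ^ m)))
          (tableRed (Lc ^ m) (Wbf (cE₂ (Lc ^ m)) (cJ4 (Lc ^ m)) (cΛ₂ (Lc ^ m)) (cR₂ (Lc ^ m)) (cQ₂ (Lc ^ m))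
            (WE (Lc ^ m)) (WJ (Lc ^ m)) (WΛ (Lc ^ m)) (WR (Lc ^ m)) (WQ (Lc ^ m)))) μ ν z
        + ωgh (Lc ^ m) * PghQ (Lc ^ m) a (x₀ (Lc ^ m)) (cK (Lc ^ m)) (cQ (Lc ^ m)) μ ν z
        + (legCross ((2 : ℝ)⁻¹ • Ga (Lc ^ m) a)
            ((-(2 : ℝ)⁻¹) • blk (sandP (Lc ^ m) (Ga (Lc ^ m) a) (multM (Lc ^ m) (2 * a / ((Lc ^ m : ℕ) : ℝ) ^ 8) 2)) true true)
            (ffV (vertexOfK (coDressKBmAt (toSite (r (Lc ^ m))) (Lc ^ m) (KInvStep (d := 3) (Lc ^ m) 0)) (Lc ^ m) (SN ((Lc ^ m) - 1) a (S (Lc ^ m))))) (ffW (W2NInf ((Lc ^ m) - 1) a (r (Lc ^ m)) (S₂ (Lc ^ m)))) μ ν z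
          + blockTerms (NlegRoad ((Lc ^ m) - 1) a) (vertexOfK (coDressKBmAt (toSite (r (Lc ^ m))) (Lc ^ m) (KInvStep (d := 3) (Lc ^ m) 0)) (Lc ^ m) (SN ((Lc ^ m) - 1) a (S (Lc ^ m)))) (W2NInf ((Lc ^ m) - 1) a (r (Lc ^ m)) (S₂ (Lc ^ m))) μ ν z
          + 2 * hessKer idK1
          (fun κ' v => fun x y c b => ∑ κ : Fin 4, wsum (colH (coDressKBmAt (toSite (r (Lc ^ m))) (Lc ^ m) (KInvStep (d := 3) (Lc ^ m) 0)) (Lc ^ m) κ' v κ) (nFcol (r (Lc ^ m)) (Lc ^ m) κ) x y c b)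
          (fun κ' v l v' => fun x y c b => ∑ κ : Fin 4, wsum (colH (coDressKBmAt (toSite (r (Lc ^ m))) (Lc ^ m) (KInvStep (d := 3) (Lc ^ m) 0)) (Lc ^ m) κ' v κ)
            (fun u => fun x y c b => colH (coDressKBmAt (toSite (r (Lc ^ m))) (Lc ^ m) (KInvStep (d := 3) (Lc ^ m) 0)) (Lc ^ m) l v' κ u * nFcol (r (Lc ^ m)) (Lc ^ m) κ u x y c b) x y c b)
          μ ν z
          + RJ2 (Lc ^ m) μ ν z + RJ3 (Lc ^ m) μ ν z
          + ∑ i : GhIdx, ghostWordK (Ggh (Lc ^ m) a) (Pgt (Lc ^ m) a)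
              (fun κ' v => (((Lc ^ m : ℕ) : ℝ) ^ 2) • (fun x y a b => ∑ κ : Fin 4,
                wsum (colH (coDressKBmAt (toSite (r (Lc ^ m))) (Lc ^ m) (KInvStep (d := 3) (Lc ^ m) 0)) (Lc ^ m) κ' v κ) (ghCur κ) x y a b))
              (fun κ' v l v' => (((Lc ^ m : ℕ) : ℝ) ^ 2) • (fun x y a b => ∑ κ : Fin 4,
                wsum (colH (coDressKBmAt (toSite (r (Lc ^ m))) (Lc ^ m) (KInvStep (d := 3) (Lc ^ m) 0)) (Lc ^ m) κ' v κ)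
                  (fun u => fun x y a b => colH (coDressKBmAt (toSite (r (Lc ^ m))) (Lc ^ m) (KInvStep (d := 3) (Lc ^ m) 0)) (Lc ^ m) l v' κ u * gh₂ κ u x y a b) x y a b))
              i μ ν z) := by
  intro m hm z
  have hn : 2 ≤ Lc ^ m := hL.trans (by simpa using Nat.pow_le_pow_right (Nat.pos_of_ne_zero (NeZero.ne Lc)) hm)
  exact tshot_eq_hptw_form_at (Lc ^ m) ha (spr_Ga_of_prop12 ha h12 h126 (Lc ^ m)) (hr _ hn) (S (Lc ^ m)) (hS _ hn) (hCs _) (hδS _) (hScovB _ hn)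
    (hSmm _ hn) (hSfm _ hn) (hSff _ hn) (S₂ (Lc ^ m)) (hS₂ _ hn) (hCk _) (hδ₂ _) (hS₂covB _ hn) (hS₂mm _ hn) (hS₂fm _ hn) (hS₂ff _ hn) μ ν z
    (hp (Lc ^ m)) (K₁ (Lc ^ m)) (Q₁ (Lc ^ m)) (x₁ (Lc ^ m)) (K₂ (Lc ^ m)) (Q₂ (Lc ^ m)) (x₂ (Lc ^ m)) (hK₁ _ hn) (hQ₁ _ hn) (hx₁ _ hn)
    (hK₂ _ hn) (hQ₂ _ hn) (hx₂ _ hn) (hK₁0 _ hn) (hQ₁0 _ hn) (hx₁0 _ hn) (hK₂0 _ hn) (hK₂0' _ hn) (hQ₂0 _ hn) (hQ₂0' _ hn) (hx₂0 _ hn)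
    (hx₂0' _ hn) C hC (hP1 _ hn) (hP2 _ hn) Jc m (hJ1 m hm z) (ωgl (Lc ^ m)) _ _ (RJ2 (Lc ^ m) μ ν z) (hJ2 _ hn z) (ωgh (Lc ^ m)) (x₀ (Lc ^ m))
    (cK (Lc ^ m)) (cQ (Lc ^ m)) (RJ3 (Lc ^ m) μ ν z) (hJ3 _ hn z)

end Summit.QuantumFields.BalabanUV.Beta.D1BFx.PackedRoadHptwScales

end
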